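import Literature.IUT.LogThetaLattice.TensorPackets
import Literature.IUT.LogVolume.ArchimedeanTensorCopiesInvariance
import Literature.IUT.LogVolume.ArchimedeanTensorCopiesDecomposition
import Mathlib.LinearAlgebra.BilinearForm.TensorProduct
import Mathlib.Analysis.InnerProductSpace.Basic
import HarnessLib

/-!
# [IUTchIII] Proposition 3.2 (ii) at archimedean `v_ℚ`: the Hermitian integral structures of the tensor packets

S. Mochizuki, *Inter-universal Teichmüller theory III*, kurims manuscript (May 2020), §3, Proposition
3.2 "(Local Mono-analytic Tensor Packets)" (ii) "(Integral Structures)", ARCHIMEDEAN case, p. 99 (node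
**IUTchIII:Prop3.2(ii)**): "if `𝕍 ∋ v | v_ℚ ∈ 𝕍^arc_ℚ`, then by regarding the mono-analytic log-shell
`𝓘_{†𝒟^⊢_v} ⊆ log(†𝒟^⊢_v)` as the 'closed unit ball' of a Hermitian metric on `log(†𝒟^⊢_v)` [cf.
[AbsTopIII], Proposition 5.8, (v)], and considering the induced direct sum Hermitian metric on
`log(^α𝒟^⊢_{v_ℚ})`, together with the induced tensor product Hermitian metric on `log(^A𝒟^⊢_{v_ℚ})`,
one obtains Hermitian metrics on `log(^α𝒟^⊢_{v_ℚ})`, `log(^A𝒟^⊢_{v_ℚ})`, `log(^{A,α}𝒟^⊢_v)`, whose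
associated closed unit balls `𝓘(^α𝒟^⊢_{v_ℚ})`; `𝓘(^A𝒟^⊢_{v_ℚ})`; `𝓘(^{A,α}𝒟^⊢_v)` may be regarded as
integral structures on the `ℚ`-spans `𝓘^ℚ(…)` …". [claim: Mochizuki2012, status: disputed]

WHAT THIS FILE SUPPLIES. `TensorPackets.lean` (abc-iut-L6-t4, p403825) types the archimedean clause as
the INTERFACE `ArchimedeanShellData 𝕜 D I` (fields `ball1`, `ballN`, `ballAt`; sole constraint
`ball1 ⊆ Π balls`); `Summits/ABC/IUTFork/Thm311Real2.lean` (abc-iut-c312-5) carries the archimedean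
integral structures as BINDERS `archPk`, `archSub` ("an object needing a Hermitian structure on the
packet that no landed decl supplies"). Here the GENUINE Hermitian inhabitant is constructed over the
archimedean component modules `log(^α𝒟^⊢_v) = ℂ` (`ArchComponents A V`), for which the mono-analytic
tensor packets ARE, definitionally, the archimedean tensor copies `M V = ⊕_v ℂ_v`, `MI A V = ⊗_{α∈A} M`
of `Literature.IUT.LogVolume.ArchimedeanTensorCopies` ([IUTchIV] Prop. 1.5 (iii); abc-iut-L5-t7/S2):
direct sum metric `dsInner`, tensor product metric `tensorForm` (THE tensor metric:
`isTensorMetric_tensorForm` / `_unique`). With log-shell radius `r` (`= π` in the series) the metrics are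
normalised so that the log-shell is the unit ball; staying in `ℝ` without rescaling the forms, the
unit balls are the sublevel sets `Σ_v |m_v|² ≤ r²`, `B₀(x,x) ≤ (r²)^{|A|}`, `(⟪·,·⟫ ⊗ B₀)(t,t) ≤ (r²)^{|A|}`.

PROVED (classical finite-dimensional algebra, no disputed input): the interface constraint
`𝓘(^α𝒟^⊢_{v_ℚ}) ⊆ Π_v 𝓘_v` and its converse up to `√|V|`; pure tensors of shell vectors lie in the
tensor-packet shells ([IUTchIII] Prop. 3.9 (ii) "tensor product of log-shells"); invariance of
`𝓘(^A𝒟^⊢_{v_ℚ})` under the automorphisms induced by isometries of the summands `ℂ_v` ([IUTchIV]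
Prop. 1.5 (iii), last clause); and the two-sided COMPARISON with [IUTchIV] Prop. 1.5 (iii)'s integral
structure `B_I` of ANY direct sum decomposition `Φ` into `2^{|A|−1}·|V|^{|A|}` copies of `ℂ`:
`𝓘(^A𝒟^⊢_{v_ℚ}) ⊆ (2^{(|A|−1)/2}·r^{|A|})·B_I`, `B_I ⊆ (|V|^{|A|/2}·r^{−|A|})·𝓘(^A𝒟^⊢_{v_ℚ})` — the
archimedean instance of "the direct sum metric on `M_I` is `2^{|I|−1}` times the tensor product
metric", which [IUTchIV] §1 uses to pass between the two integral structures in log-volume estimates.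
Record-only typing under the claim key `Mochizuki2012` (D-0012, disputed): no disputed claim is
asserted; nothing here takes a side on [IUTchIII] Cor. 3.12; typed ≠ discharged.
-/

noncomputable section

namespace Literature.IUT.LogThetaLattice

open scoped TensorProduct Pointwise
open PiTensorProduct Literature.IUT.LogVolume Literature.IUT.LogVolume.Prop15iii

variable (A V : Type) [Fintype A] [DecidableEq A] [Fintype V] [DecidableEq V]

/-! ### The archimedean component modules and the identification with the archimedean tensor copies -/

/-- **IUTchIII:Prop3.2(ii)** (archimedean `v_ℚ`, kurims p. 99): the component modules
`log(^α𝒟^⊢_v) ≅ ℂ` (`α ∈ A`, `𝕍 ∋ v | v_ℚ` archimedean), as real vector spaces ([IUTchIII] Prop. 1.2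
(vi), (vii); [AbsTopIII] Prop. 5.8 (iv), (v): at a complex place `log(†𝒟^⊢_v)` is a copy of `ℂ` with its
standard metric, well defined up to `{±1} × {id, conj}`). [claim: Mochizuki2012, status: disputed] -/
abbrev ArchComponents : A → V → Type := fun _ _ => ℂ

omit [Fintype A] [DecidableEq A] [Fintype V] [DecidableEq V] in
/-- The archimedean 1-tensor packet `log(^α𝒟^⊢_{v_ℚ}) = ⊕_v ℂ_v` of `TensorPackets.lean` IS the module
`M V` of [IUTchIV] Prop. 1.5 (iii) (`ArchimedeanTensorCopies`), definitionally.
[claim: Mochizuki2012, status: disputed] -/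
theorem mPacket1_archComponents_eq (α : A) : MPacket1 (ArchComponents A V) α = M V := rfl

omit [Fintype A] [DecidableEq A] [Fintype V] [DecidableEq V] in
/-- The archimedean `n`-tensor packet `log(^A𝒟^⊢_{v_ℚ}) = ⊗_{α∈A} ⊕_v ℂ_v` of `TensorPackets.lean` IS
the module `M_A = MI A V` of [IUTchIV] Prop. 1.5 (iii), definitionally.
[claim: Mochizuki2012, status: disputed] -/
theorem mPacketN_archComponents_eq : MPacketN ℝ (ArchComponents A V) = MI A V := rfl

/-! ### The three Hermitian unit balls -/

/-- **IUTchIII:Prop3.2(ii)**, archimedean, first ball (kurims p. 99): `𝓘(^α𝒟^⊢_{v_ℚ}) ⊆ log(^α𝒟^⊢_{v_ℚ})`,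
the closed unit ball of "the induced direct sum Hermitian metric" on `⊕_v ℂ_v`, each summand being
normalised so that its log-shell (the closed ball of radius `r`; `r = π` in the series) is the unit
ball: `{m | Σ_v |m_v|² ≤ r²}`, written with the direct sum metric `dsInner`.
[claim: Mochizuki2012, status: disputed] -/
def hermitianBall1 (r : ℝ) (α : A) : Set (MPacket1 (ArchComponents A V) α) :=
  {m | dsInner V m m ≤ r ^ 2}

/-- **IUTchIII:Prop3.2(ii)**, archimedean, second ball (kurims p. 99): `𝓘(^A𝒟^⊢_{v_ℚ}) ⊆ log(^A𝒟^⊢_{v_ℚ})`,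
the closed unit ball of "the induced tensor product Hermitian metric" on `⊗_{α∈A} ⊕_v ℂ_v`:
`{x | B₀(x,x) ≤ (r²)^{|A|}}` with `B₀ = tensorForm` THE tensor product metric
(`B₀(⊗m_α, ⊗m'_α) = ∏_α ⟪m_α, m'_α⟫`, [IUTchIV] Prop. 1.5 (iii)). [claim: Mochizuki2012, status: disputed] -/
def hermitianBallN (r : ℝ) : Set (MPacketN ℝ (ArchComponents A V)) :=
  {x | tensorForm A V x x ≤ (r ^ 2) ^ Fintype.card A}

/-- The tensor product Hermitian metric on `log(^{A,α}𝒟^⊢_v) = ℂ_v ⊗ (⊗_{β≠α} ⊕_w ℂ_w)` (kurims p. 99):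
the real inner product of `ℂ` tensored with the tensor product metric of the remaining factors
(Mathlib `LinearMap.BilinForm.tmul`: `(z ⊗ x, z' ⊗ x') ↦ B₀(x,x')·⟪z,z'⟫`).
[claim: Mochizuki2012, status: disputed] -/
def atForm (α : A) (v : V) : LinearMap.BilinForm ℝ (MPacketAt ℝ (ArchComponents A V) α v) :=
  LinearMap.BilinForm.tmul (innerₗ ℂ) (tensorForm {β : A // β ≠ α} V)

/-- **IUTchIII:Prop3.2(ii)**, archimedean, third ball (kurims p. 99): `𝓘(^{A,α}𝒟^⊢_v) ⊆ log(^{A,α}𝒟^⊢_v)`,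
the closed unit ball of the tensor product Hermitian metric on `ℂ_v ⊗ (⊗_{β≠α} ⊕_w ℂ_w)`:
`{t | (⟪·,·⟫ ⊗ B₀)(t,t) ≤ (r²)^{|A|}}` (one factor `r²` for `ℂ_v`, `|A|−1` factors for the `β ≠ α`).
[claim: Mochizuki2012, status: disputed] -/
def hermitianBallAt (r : ℝ) (α : A) (v : V) : Set (MPacketAt ℝ (ArchComponents A V) α v) :=
  {t | atForm A V α v t t ≤ (r ^ 2) ^ Fintype.card A}

variable {A V}

omit [DecidableEq V] in
/-- `dsInner m m = Σ_v |m_v|²`. [claim: Mochizuki2012, status: disputed] -/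
theorem dsInner_self_eq (m : M V) : dsInner V m m = ∑ v, ‖m v‖ ^ 2 := by
  simp only [dsInner, real_inner_self_eq_norm_sq]

omit [DecidableEq V] in
/-- `dsInner m m ≥ 0`. [claim: Mochizuki2012, status: disputed] -/
theorem dsInner_self_nonneg (m : M V) : 0 ≤ dsInner V m m := by
  rw [dsInner_self_eq]
  exact Finset.sum_nonneg fun v _ => sq_nonneg _

omit [Fintype A] [DecidableEq A] [DecidableEq V] in
/-- Membership in the first ball: `m ∈ 𝓘(^α𝒟^⊢_{v_ℚ}) ⟺ Σ_v |m_v|² ≤ r²`.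
[claim: Mochizuki2012, status: disputed] -/
theorem mem_hermitianBall1_iff {r : ℝ} {α : A} {m : MPacket1 (ArchComponents A V) α} :
    m ∈ hermitianBall1 A V r α ↔ ∑ v, ‖m v‖ ^ 2 ≤ r ^ 2 := by
  simp only [hermitianBall1, Set.mem_setOf_eq, dsInner_self_eq]

omit [DecidableEq V] in
/-- Membership in the second ball: `x ∈ 𝓘(^A𝒟^⊢_{v_ℚ}) ⟺ B₀(x,x) ≤ (r²)^{|A|}`.
[claim: Mochizuki2012, status: disputed] -/
theorem mem_hermitianBallN_iff {r : ℝ} {x : MPacketN ℝ (ArchComponents A V)} :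
    x ∈ hermitianBallN A V r ↔ tensorForm A V x x ≤ (r ^ 2) ^ Fintype.card A := Iff.rfl

omit [DecidableEq V] in
/-- Membership in the third ball. [claim: Mochizuki2012, status: disputed] -/
theorem mem_hermitianBallAt_iff {r : ℝ} {α : A} {v : V} {t : MPacketAt ℝ (ArchComponents A V) α v} :
    t ∈ hermitianBallAt A V r α v ↔ atForm A V α v t t ≤ (r ^ 2) ^ Fintype.card A := Iff.rfl

/-! ### The interface constraint and its converse up to `√|V|` -/

omit [Fintype A] [DecidableEq A] [DecidableEq V] in
/-- **IUTchIII:Prop3.2(ii)** (kurims p. 99), the direct-sum-metric compatibility recorded as the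
constraint field of `ArchimedeanShellData`: the unit ball of the direct sum Hermitian metric lies in
the product of the log-shells, `𝓘(^α𝒟^⊢_{v_ℚ}) ⊆ Π_v 𝓘_{^α𝒟^⊢_v}` (each `|m_v|² ≤ Σ_w |m_w|² ≤ r²`).
[claim: Mochizuki2012, status: disputed] -/
theorem hermitianBall1_subset_pi {r : ℝ} (hr : 0 ≤ r) (α : A) :
    hermitianBall1 A V r α ⊆ Set.univ.pi fun _ : V => Metric.closedBall (0 : ℂ) r := by
  intro m hm
  rw [mem_hermitianBall1_iff] at hm
  simp only [Set.mem_pi, Set.mem_univ, forall_const, Metric.mem_closedBall, dist_zero_right]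
  intro v
  have hv : ‖m v‖ ^ 2 ≤ r ^ 2 :=
    le_trans (Finset.single_le_sum (fun w _ => sq_nonneg ‖m w‖) (Finset.mem_univ v)) hm
  exact (sq_le_sq₀ (norm_nonneg _) hr).mp hv

omit [Fintype A] [DecidableEq A] [DecidableEq V] in
/-- Conversely the product of the log-shells lies in the `√|V|`-dilate of the Hermitian unit ball:
`Π_v 𝓘_{^α𝒟^⊢_v} ⊆ {Σ_v |m_v|² ≤ |V|·r²}` (the two candidate integral structures on `log(^α𝒟^⊢_{v_ℚ})`
agree up to the factor `√|V|`). [claim: Mochizuki2012, status: disputed] -/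
theorem pi_closedBall_subset_hermitianBall1 (r : ℝ) (α : A) :
    (Set.univ.pi fun _ : V => Metric.closedBall (0 : ℂ) r) ⊆
      hermitianBall1 A V (Real.sqrt (Fintype.card V) * r) α := by
  intro m hm
  simp only [Set.mem_pi, Set.mem_univ, forall_const, Metric.mem_closedBall, dist_zero_right] at hm
  rw [mem_hermitianBall1_iff, mul_pow, Real.sq_sqrt (Nat.cast_nonneg _)]
  calc ∑ v, ‖m v‖ ^ 2 ≤ ∑ _v : V, r ^ 2 :=
        Finset.sum_le_sum fun v _ => pow_le_pow_left₀ (norm_nonneg _) (hm v) 2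
    _ = Fintype.card V * r ^ 2 := by simp

/-! ### Pure tensors of shell vectors lie in the tensor-packet shells -/

omit [DecidableEq V] in
/-- `B₀(⊗m_α, ⊗m_α) = ∏_α Σ_v |m_{α,v}|²` (the tensor product metric on pure tensors).
[claim: Mochizuki2012, status: disputed] -/
theorem tensorForm_tprod_self (m : A → M V) :
    tensorForm A V (tprod ℝ m) (tprod ℝ m) = ∏ α, dsInner V (m α) (m α) :=
  isTensorMetric_tensorForm A V m m

omit [DecidableEq V] in
/-- **IUTchIII:Prop3.2(ii)** / Prop. 3.9 (ii) "tensor product of log-shells": a pure tensor of vectors of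
the Hermitian unit balls `𝓘(^α𝒟^⊢_{v_ℚ})` lies in `𝓘(^A𝒟^⊢_{v_ℚ})`:
`∏_α Σ_v |m_{α,v}|² ≤ ∏_α r² = (r²)^{|A|}`. [claim: Mochizuki2012, status: disputed] -/
theorem tprod_mem_hermitianBallN {r : ℝ} {m : ∀ α : A, MPacket1 (ArchComponents A V) α}
    (hm : ∀ α, m α ∈ hermitianBall1 A V r α) :
    tprod ℝ m ∈ hermitianBallN A V r := by
  rw [mem_hermitianBallN_iff]
  change tensorForm A V (tprod ℝ m) (tprod ℝ m) ≤ _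
  calc tensorForm A V (tprod ℝ m) (tprod ℝ m) = ∏ α, dsInner V (m α) (m α) := tensorForm_tprod_self m
    _ ≤ ∏ _α : A, r ^ 2 := Finset.prod_le_prod (fun α _ => dsInner_self_nonneg (m α)) fun α _ => hm α
    _ = (r ^ 2) ^ Fintype.card A := by rw [Finset.prod_const, Finset.card_univ]

omit [DecidableEq V] in
/-- The third metric on elementary tensors: `(⟪·,·⟫ ⊗ B₀)(z ⊗ x, z' ⊗ x') = B₀(x,x')·⟪z,z'⟫_ℝ`.
[claim: Mochizuki2012, status: disputed] -/
theorem atForm_tmul (α : A) (v : V) (z z' : ℂ)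
    (x x' : ⨂[ℝ] β : {β : A // β ≠ α}, MPacket1 (ArchComponents A V) β.1) :
    atForm A V α v (z ⊗ₜ x) (z' ⊗ₜ x') = tensorForm {β : A // β ≠ α} V x x' * inner ℝ z z' := by
  simp [atForm, LinearMap.BilinForm.tensorDistrib_tmul]

omit [DecidableEq V] in
/-- **IUTchIII:Prop3.2(ii)**, third inclusion on generators: for `z` in the log-shell of `ℂ_v` (radius `r`)
and `y_β ∈ 𝓘(^β𝒟^⊢_{v_ℚ})` (`β ≠ α`), the elementary tensor `z ⊗ (⊗_β y_β)` lies in `𝓘(^{A,α}𝒟^⊢_v)`: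
`|z|²·∏_{β≠α} Σ_w |y_{β,w}|² ≤ r²·(r²)^{|A|−1} = (r²)^{|A|}`. [claim: Mochizuki2012, status: disputed] -/
theorem tmul_tprod_mem_hermitianBallAt {r : ℝ} (α : A) (v : V) {z : ℂ}
    (hz : ‖z‖ ≤ r) {y : ∀ β : {β : A // β ≠ α}, MPacket1 (ArchComponents A V) β.1}
    (hy : ∀ β, y β ∈ hermitianBall1 A V r β.1) :
    z ⊗ₜ tprod ℝ y ∈ hermitianBallAt A V r α v := by
  rw [mem_hermitianBallAt_iff, atForm_tmul, real_inner_self_eq_norm_sq]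
  have hB : tensorForm {β : A // β ≠ α} V (tprod ℝ y) (tprod ℝ y) ≤
      (r ^ 2) ^ Fintype.card {β : A // β ≠ α} :=
    calc tensorForm {β : A // β ≠ α} V (tprod ℝ y) (tprod ℝ y) = ∏ β, dsInner V (y β) (y β) :=
          isTensorMetric_tensorForm _ V y y
      _ ≤ ∏ _β : {β : A // β ≠ α}, r ^ 2 :=
          Finset.prod_le_prod (fun β _ => dsInner_self_nonneg (y β)) fun β _ => hy β
      _ = (r ^ 2) ^ Fintype.card {β : A // β ≠ α} := by rw [Finset.prod_const, Finset.card_univ]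
  have hcard : Fintype.card {β : A // β ≠ α} + 1 = Fintype.card A := by
    rw [Fintype.card_subtype_compl (· = α), Fintype.card_subtype_eq]
    exact Nat.sub_add_cancel (Fintype.card_pos_iff.mpr ⟨α⟩)
  have hz2 : ‖z‖ ^ 2 ≤ r ^ 2 := pow_le_pow_left₀ (norm_nonneg _) hz 2
  calc tensorForm {β : A // β ≠ α} V (tprod ℝ y) (tprod ℝ y) * ‖z‖ ^ 2
      ≤ (r ^ 2) ^ Fintype.card {β : A // β ≠ α} * r ^ 2 :=
        mul_le_mul hB hz2 (sq_nonneg _) (pow_nonneg (sq_nonneg _) _)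
    _ = (r ^ 2) ^ Fintype.card A := by rw [← hcard]; exact (pow_succ (r ^ 2) _).symm

/-! ### Symmetries: the tensor-packet shell is preserved by isometries of the summands `ℂ_v` -/

omit [DecidableEq V] in
/-- **[IUTchIV] Prop. 1.5 (iii), last clause, for the Hermitian ball**: the automorphism of
`log(^A𝒟^⊢_{v_ℚ})` induced by a family `σ = (σ_{α,v})` of `ℝ`-linear isometries of the summands `ℂ_v`
(in particular by the primitive automorphisms `{±1, ±√−1} ⋊ {id, conj}` — the indeterminacy in the
identification `log(†𝒟^⊢_v) ≅ ℂ`) maps `𝓘(^A𝒟^⊢_{v_ℚ})` into itself (the tensor metric is `σ`-invariant,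
`tensorMetric_induced`). [claim: Mochizuki2012, status: disputed] -/
theorem mapsTo_hermitianBallN_induced (r : ℝ) (σ : A → V → (ℂ ≃ₗᵢ[ℝ] ℂ)) :
    Set.MapsTo (induced A V σ) (hermitianBallN A V r) (hermitianBallN A V r) := by
  intro x hx
  rw [mem_hermitianBallN_iff] at hx ⊢
  rwa [tensorMetric_induced A V σ (isTensorMetric_tensorForm A V)]

omit [DecidableEq V] in
/-- … and ONTO itself (`induced σ` is invertible with inverse `induced σ⁻¹`), so the Hermitian integral
structure `𝓘(^A𝒟^⊢_{v_ℚ})` does not depend on the choices of identifications `log(†𝒟^⊢_v) ≅ ℂ`.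
[claim: Mochizuki2012, status: disputed] -/
theorem image_hermitianBallN_induced (r : ℝ) (σ : A → V → (ℂ ≃ₗᵢ[ℝ] ℂ)) :
    induced A V σ '' hermitianBallN A V r = hermitianBallN A V r := by
  refine Set.Subset.antisymm (mapsTo_hermitianBallN_induced r σ).image_subset fun x hx => ?_
  refine ⟨induced A V (fun α v => (σ α v).symm) x, mapsTo_hermitianBallN_induced r _ hx, ?_⟩
  have h := induced_symm_apply A V (fun α v => (σ α v).symm) x
  simpa using h

/-! ### Comparison with the integral structure `B_I` of [IUTchIV] Prop. 1.5 (iii) -/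

omit [DecidableEq V] in
/-- `B₀(c·x, c·x) = c²·B₀(x,x)`. [claim: Mochizuki2012, status: disputed] -/
theorem tensorForm_smul_smul (c : ℝ) (x : MI A V) :
    tensorForm A V (c • x) (c • x) = c ^ 2 * tensorForm A V x x := by
  simp only [map_smul, LinearMap.smul_apply, smul_eq_mul]
  ring

omit [DecidableEq V] in
/-- Scaling the Hermitian ball: `c·𝓘_r = 𝓘_{…}`-type membership, `x ∈ c·hermitianBallN r ⟺ c⁻¹x ∈ hermitianBallN r`
for `c ≠ 0`. [claim: Mochizuki2012, status: disputed] -/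
theorem mem_smul_hermitianBallN_iff {c : ℝ} (hc : c ≠ 0) {r : ℝ} {x : MPacketN ℝ (ArchComponents A V)} :
    x ∈ c • hermitianBallN A V r ↔ c⁻¹ • x ∈ hermitianBallN A V r := by
  constructor
  · rintro ⟨y, hy, rfl⟩
    simpa [smul_smul, inv_mul_cancel₀ hc] using hy
  · intro h
    exact ⟨c⁻¹ • x, h, by simp [smul_smul, mul_inv_cancel₀ hc]⟩

omit [DecidableEq V] in
/-- **Comparison, first half** ([IUTchIV] Prop. 1.5 (iii) "the direct sum metric on `M_I` … is equal to
`2^{|I|−1}` times the original tensor product metric", applied to the Hermitian ball): for EVERY direct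
sum decomposition `Φ` of `log(^A𝒟^⊢_{v_ℚ})` into copies of `ℂ`,
`𝓘(^A𝒟^⊢_{v_ℚ}) ⊆ (√(2^{|A|−1})·r^{|A|}) · B_I` — each coordinate satisfies
`|Φ(x)_j|² ≤ Σ_j |Φ(x)_j|² = 2^{|A|−1}·B₀(x,x) ≤ 2^{|A|−1}·(r²)^{|A|}`. [claim: Mochizuki2012, status: disputed] -/
theorem hermitianBallN_subset_smul_ball {r : ℝ} (hr : 0 < r) {J : Type} [Fintype J]
    (Φ : Decomposition A V J) :
    hermitianBallN A V r ⊆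
      (Real.sqrt (2 ^ (Fintype.card A - 1)) * r ^ Fintype.card A) • ball Φ := by
  intro x hx
  set c : ℝ := Real.sqrt (2 ^ (Fintype.card A - 1)) * r ^ Fintype.card A with hc_def
  have hc : 0 < c := mul_pos (Real.sqrt_pos.mpr (pow_pos two_pos _)) (pow_pos hr _)
  have hmetric : dsNormSq Φ x = 2 ^ (Fintype.card A - 1) * tensorForm A V x x :=
    prop15iii_metric_holds A V J Φ (tensorForm A V) (isTensorMetric_tensorForm A V) x
  have hc2 : c ^ 2 = 2 ^ (Fintype.card A - 1) * (r ^ 2) ^ Fintype.card A := by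
    have hrr : (r ^ Fintype.card A) ^ 2 = (r ^ 2) ^ Fintype.card A := by
      rw [← pow_mul, ← pow_mul, mul_comm]
    rw [hc_def, mul_pow, Real.sq_sqrt (pow_nonneg two_pos.le _), hrr]
  have hsum : dsNormSq Φ x ≤ c ^ 2 := by
    rw [hmetric, hc2]
    exact mul_le_mul_of_nonneg_left (mem_hermitianBallN_iff.mp hx) (pow_nonneg two_pos.le _)
  refine ⟨c⁻¹ • x, ?_, by simp [smul_smul, mul_inv_cancel₀ hc.ne']⟩
  show ∀ j, ‖Φ (c⁻¹ • x) j‖ ≤ 1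
  intro j
  have hj : ‖Φ x j‖ ^ 2 ≤ c ^ 2 :=
    le_trans (Finset.single_le_sum (fun k _ => sq_nonneg ‖Φ x k‖) (Finset.mem_univ j)) hsum
  have hj' : ‖Φ x j‖ ≤ c := (sq_le_sq₀ (norm_nonneg _) hc.le).mp hj
  rw [map_smul, Pi.smul_apply, norm_smul, Real.norm_eq_abs, abs_inv, abs_of_pos hc]
  calc c⁻¹ * ‖Φ x j‖ ≤ c⁻¹ * c := mul_le_mul_of_nonneg_left hj' (inv_nonneg.mpr hc.le)
    _ = 1 := inv_mul_cancel₀ hc.ne'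

/-- **Comparison, second half**: for EVERY direct sum decomposition `Φ` (there are `|J| = 2^{|A|−1}·|V|^{|A|}`
copies, `card_eq_of_decomposition`), `B_I ⊆ (√(|V|^{|A|})·r^{−|A|}) · 𝓘(^A𝒟^⊢_{v_ℚ})` —
`2^{|A|−1}·B₀(x,x) = Σ_j |Φ(x)_j|² ≤ |J|`, so `B₀(x,x) ≤ |V|^{|A|}`. Together with the first half: the
Hermitian integral structure of [IUTchIII] Prop. 3.2 (ii) and the computational integral structure
`B_I` of [IUTchIV] Prop. 1.5 (iii) bound each other by the explicit constants `2^{(|A|−1)/2}`,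
`|V|^{|A|/2}` (log-volume discrepancy `≤ dim·O(|A| + |A|·log|V|)`). [claim: Mochizuki2012, status: disputed] -/
theorem ball_subset_smul_hermitianBallN {r : ℝ} (hr : 0 < r) {J : Type} [Fintype J] [DecidableEq J]
    (Φ : Decomposition A V J) :
    ball Φ ⊆ (Real.sqrt ((Fintype.card V : ℝ) ^ Fintype.card A) / r ^ Fintype.card A) •
      hermitianBallN A V r := by
  classical
  rcases isEmpty_or_nonempty A with hA | hA
  · exact (isEmpty_decomposition_of_isEmpty A V Φ).elim
  intro x hx
  set N : ℝ := (Fintype.card V : ℝ) ^ Fintype.card A with hN_def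
  set s : ℝ := Real.sqrt N / r ^ Fintype.card A with hs_def
  have hrA : 0 < r ^ Fintype.card A := pow_pos hr _
  -- the decomposition has `2^{|A|-1}·|V|^{|A|}` coordinates, each of norm `≤ 1` on `B_I`
  have hcard : (Fintype.card J : ℝ) = 2 ^ (Fintype.card A - 1) * N := by
    rw [hN_def]
    exact_mod_cast card_eq_of_decomposition (I := A) (V := V) Φ
  have hsum : dsNormSq Φ x ≤ Fintype.card J := by
    calc dsNormSq Φ x = ∑ j, ‖Φ x j‖ ^ 2 := rfl
      _ ≤ ∑ _j : J, (1 : ℝ) := Finset.sum_le_sum fun j _ => by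
          calc ‖Φ x j‖ ^ 2 ≤ 1 ^ 2 := pow_le_pow_left₀ (norm_nonneg _) (hx j) 2
            _ = 1 := one_pow 2
      _ = Fintype.card J := by simp
  have hmetric : dsNormSq Φ x = 2 ^ (Fintype.card A - 1) * tensorForm A V x x :=
    prop15iii_metric_holds A V J Φ (tensorForm A V) (isTensorMetric_tensorForm A V) x
  have hB : tensorForm A V x x ≤ N := by
    have h2 : (0 : ℝ) < 2 ^ (Fintype.card A - 1) := pow_pos two_pos _
    rw [hmetric, hcard] at hsum
    exact le_of_mul_le_mul_left hsum h2
  rcases (pow_nonneg (Nat.cast_nonneg (Fintype.card V)) (Fintype.card A) : (0 : ℝ) ≤ N).eq_or_lt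
    with hN | hN
  · -- `|V|^{|A|} = 0` (i.e. `V = ∅`): then `B₀(x,x) ≤ 0`, so `x = 0 ∈ 0 • 𝓘`
    have hx0 : x = 0 :=
      eq_zero_of_tensorForm_self_eq_zero A V (le_antisymm (hN ▸ hB) (tensorForm_self_nonneg A V x))
    have hN0 : N = 0 := hN.symm
    have hs0 : s = 0 := by rw [hs_def, hN0, Real.sqrt_zero, zero_div]
    rw [hx0, hs0]
    refine ⟨0, ?_, smul_zero 0⟩
    simp only [mem_hermitianBallN_iff, map_zero]
    exact pow_nonneg (sq_nonneg r) _
  · have hs : 0 < s := div_pos (Real.sqrt_pos.mpr hN) hrA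
    refine ⟨s⁻¹ • x, ?_, by simp [smul_smul, mul_inv_cancel₀ hs.ne']⟩
    rw [mem_hermitianBallN_iff]
    have hsinv : s⁻¹ ^ 2 = (r ^ 2) ^ Fintype.card A / N := by
      have hrr : (r ^ Fintype.card A) ^ 2 = (r ^ 2) ^ Fintype.card A := by
        rw [← pow_mul, ← pow_mul, mul_comm]
      rw [hs_def, inv_div, div_pow, Real.sq_sqrt hN.le, hrr]
    rw [tensorForm_smul_smul, hsinv]
    calc (r ^ 2) ^ Fintype.card A / N * tensorForm A V x x
        ≤ (r ^ 2) ^ Fintype.card A / N * N :=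
          mul_le_mul_of_nonneg_left hB (div_nonneg (pow_nonneg (sq_nonneg r) _) hN.le)
      _ = (r ^ 2) ^ Fintype.card A := div_mul_cancel₀ _ hN.ne'

/-! ### The genuine inhabitant of the interface `ArchimedeanShellData` -/

variable (A V)

/-- **IUTchIII:Prop3.2(ii)** (archimedean `v_ℚ`, kurims p. 99) — THE Hermitian inhabitant of
abc-iut-L6-t4's interface `ArchimedeanShellData` over the archimedean component modules `ℂ_v` with
log-shells the closed balls of radius `r ≥ 0` (`r = π`: [AbsTopIII] Prop. 5.8 (v), [IUTchIII] Rmk.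
1.2.2 (ii)): `ball1 = 𝓘(^α𝒟^⊢_{v_ℚ})` (direct sum metric), `ballN = 𝓘(^A𝒟^⊢_{v_ℚ})` (tensor product
metric), `ballAt = 𝓘(^{A,α}𝒟^⊢_v)`, with the printed compatibility `ball1 ⊆ Π_v 𝓘_v` PROVED
(`hermitianBall1_subset_pi`). This is the object the Cor 3.12 sub-crew's `Thm311Real2` binders
`archPk` / `archSub` ask for, at the level of the real tensor packet `⊗_ℝ`; a comparison map from a
`ℚ`-structured packet (e.g. `piTensorRestrictScalars ℚ ℝ`) pulls it back by preimage.
[claim: Mochizuki2012, status: disputed] -/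
def ArchimedeanShellData.hermitian {r : ℝ} (hr : 0 ≤ r) :
    ArchimedeanShellData ℝ (ArchComponents A V) (fun _ _ => Metric.closedBall (0 : ℂ) r) where
  ball1 := hermitianBall1 A V r
  ballN := hermitianBallN A V r
  ballAt := hermitianBallAt A V r
  ball1_subset_pi := hermitianBall1_subset_pi hr

omit [DecidableEq V] in
/-- The inhabitant's `ballN` IS the Hermitian tensor-packet shell (by construction).
[claim: Mochizuki2012, status: disputed] -/
theorem ArchimedeanShellData.hermitian_ballN {r : ℝ} (hr : 0 ≤ r) :
    (ArchimedeanShellData.hermitian A V hr).ballN = hermitianBallN A V r := rfl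

omit [DecidableEq V] in
/-- Non-vacuity: `0 ∈ 𝓘(^A𝒟^⊢_{v_ℚ})` (together with `tprod_mem_hermitianBallN`: the shell contains the pure
tensors of all shell vectors). [claim: Mochizuki2012, status: disputed] -/
theorem zero_mem_hermitianBallN (r : ℝ) :
    (0 : MPacketN ℝ (ArchComponents A V)) ∈ hermitianBallN A V r := by
  simp only [mem_hermitianBallN_iff, map_zero]
  exact pow_nonneg (sq_nonneg r) _

end Literature.IUT.LogThetaLattice

end
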